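import Summits.PneNP.PneNP.Theorems.CodingVolumeShiftsCodingVolumeCubeEntropy
import Literature.InformationTheory.Entropy.MapEntropyConditional
import Literature.InformationTheory.Entropy.MapEntropyPi

/-!
# Route CodingVolumeShifts — crux `CodingVolume` (stmt-PneNP-19454): conditional-entropy toolkit
# for the general `C = 4` cell

Bookkeeping for the entropy form of the `C = 4` volume argument for GENERAL (non-linear) binary
one-shot codes. Everything is phrased with `mapEntropy S F = H(F(U_S))`
(`Literature.InformationTheory.Entropy.mapEntropy`); conditional entropies are kept as explicit
differences `H(f, k) − H(k)`, and "`w` is determined by `f` on `S`" is spelled out as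
`∀ v ∈ S, ∀ u ∈ S, f v = f u → w v = w u`.

* Shannon calculus in difference form: reassociation and the chain rule
  (`codingVolume_ent_assoc`, `codingVolume_ent_chain`), monotonicity under determination
  (`codingVolume_ent_le_of_determined`, `codingVolume_ent_absorb_left`,
  `codingVolume_ent_cond_le_of_determined`), conditional subadditivity
  (`codingVolume_ent_cond_subadd`), and the CREDIT LEMMA `codingVolume_ent_credit`: if `w` is a
  function of `f` and of `k₂`, and `k₁` is a function of `k₂`, then
  `H(w | k₁) ≤ H(f | k₁) − H(f | k₂)` (the information `f` gains about `k₂` beyond `k₁` is at least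
  the entropy of any common part `w`).
* MASKED FAMILIES. A family of bits `V : Ω → α → Bool` restricted to a finite set `E` of indices is
  represented by the total function `x ↦ (b ↦ if b ∈ E then V x b else false)` (uniform codomain
  `α → Bool`): union versus pair (`codingVolume_mask_union`), finite conditional subadditivity over
  a `Finset.biUnion` (`codingVolume_mask_biUnion_le`), and `H(V|_E | k) ≤ |E|`
  (`codingVolume_mask_le_card`, one bit carries at most one bit: `codingVolume_ent_bool_le_one`).
* On the Boolean cube (`S = univ : Finset (ι → Bool)`), the masked form of "fresh independent bits
  add their number": `H(F, x|_Q) = H(F) + |Q|` and `H(x|_Q | F) = |Q|` when `F` ignores the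
  coordinates in `Q` (`codingVolume_ent_pair_coords`, `codingVolume_ent_coords_cond`, from
  `codingVolume_mapEntropy_pair_coords`).

No definitions. [folklore] (Cover–Thomas, *Elements of Information Theory*, 2nd ed., Ch. 2.)
-/

set_option linter.dupNamespace false -- `Summit.PneNP.PneNP.…`: summit = sub-problem name (D-0017)

namespace Summit.PneNP.PneNP.Theorems

open Literature.InformationTheory.Entropy Finset

section Generic

variable {Ω β β' β'' γ γ' : Type*} [DecidableEq β] [DecidableEq β'] [DecidableEq β'']
  [DecidableEq γ] [DecidableEq γ']

/-- Reassociation of a triple does not change the joint entropy. [folklore] -/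
theorem codingVolume_ent_assoc (S : Finset Ω) (f : Ω → β) (g : Ω → β') (h : Ω → β'') :
    mapEntropy S (fun v => ((f v, g v), h v)) = mapEntropy S (fun v => (f v, (g v, h v))) := by
  refine mapEntropy_eq_of_ker_eq fun a _ b _ => ?_
  simp only [Prod.mk.injEq, and_assoc]

/-- CHAIN RULE in difference form: `H(f, g | h) = H(g | h) + H(f | g, h)`. [folklore] -/
theorem codingVolume_ent_chain (S : Finset Ω) (f : Ω → β) (g : Ω → β') (h : Ω → β'') :
    mapEntropy S (fun v => ((f v, g v), h v)) - mapEntropy S h =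
      (mapEntropy S (fun v => (g v, h v)) - mapEntropy S h) +
      (mapEntropy S (fun v => (f v, (g v, h v))) - mapEntropy S (fun v => (g v, h v))) := by
  rw [codingVolume_ent_assoc]
  ring

/-- `H(f) ≤ H(g)` when `f` is determined by `g` on `S`. [folklore] -/
theorem codingVolume_ent_le_of_determined (S : Finset Ω) (f : Ω → β) (g : Ω → β')
    (hdet : ∀ v ∈ S, ∀ u ∈ S, g v = g u → f v = f u) : mapEntropy S f ≤ mapEntropy S g := by
  calc mapEntropy S f ≤ mapEntropy S (fun v => (g v, f v)) := mapEntropy_le_mapEntropy_pair S g f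
    _ = mapEntropy S (fun v => (f v, g v)) := mapEntropy_pair_comm S g f
    _ = mapEntropy S g := mapEntropy_pair_eq_right_of_determined S f g hdet

/-- Absorbing a determined component: `H((w, f), k) = H(f, k)` when `w` is determined by `f`.
[folklore] -/
theorem codingVolume_ent_absorb_left (S : Finset Ω) (w : Ω → β) (f : Ω → β') (k : Ω → γ)
    (hdet : ∀ v ∈ S, ∀ u ∈ S, f v = f u → w v = w u) :
    mapEntropy S (fun v => ((w v, f v), k v)) = mapEntropy S (fun v => (f v, k v)) := by
  refine mapEntropy_eq_of_ker_eq fun a ha b hb => ?_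
  simp only [Prod.mk.injEq]
  constructor
  · rintro ⟨⟨-, hf⟩, hk⟩
    exact ⟨hf, hk⟩
  · rintro ⟨hf, hk⟩
    exact ⟨⟨hdet a ha b hb hf, hf⟩, hk⟩

/-- Absorbing a determined quantity into the condition: `H(f, (w, k)) = H(f, k)` when `w` is
determined by `k`. [folklore] -/
theorem codingVolume_ent_absorb_cond (S : Finset Ω) (f : Ω → β) (w : Ω → β') (k : Ω → γ)
    (hdet : ∀ v ∈ S, ∀ u ∈ S, k v = k u → w v = w u) :
    mapEntropy S (fun v => (f v, (w v, k v))) = mapEntropy S (fun v => (f v, k v)) := by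
  refine mapEntropy_eq_of_ker_eq fun a ha b hb => ?_
  simp only [Prod.mk.injEq]
  constructor
  · rintro ⟨hf, -, hk⟩
    exact ⟨hf, hk⟩
  · rintro ⟨hf, hk⟩
    exact ⟨hf, hdet a ha b hb hk, hk⟩

/-- CONDITIONING ON FINER INFORMATION REDUCES CONDITIONAL ENTROPY: if `k'` is determined by `k`,
then `H(f | k) ≤ H(f | k')`. [folklore] -/
theorem codingVolume_ent_cond_le_of_determined (S : Finset Ω) (f : Ω → β) (k : Ω → γ)
    (k' : Ω → γ') (hdet : ∀ v ∈ S, ∀ u ∈ S, k v = k u → k' v = k' u) :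
    mapEntropy S (fun v => (f v, k v)) - mapEntropy S k ≤
      mapEntropy S (fun v => (f v, k' v)) - mapEntropy S k' := by
  have h1 : mapEntropy S (fun v => (f v, (k v, k' v))) = mapEntropy S (fun v => (f v, k v)) := by
    refine mapEntropy_eq_of_ker_eq fun a ha b hb => ?_
    simp only [Prod.mk.injEq]
    constructor
    · rintro ⟨hf, hk, -⟩
      exact ⟨hf, hk⟩
    · rintro ⟨hf, hk⟩
      exact ⟨hf, hk, hdet a ha b hb hk⟩
  have h2 : mapEntropy S (fun v => (k v, k' v)) = mapEntropy S k := by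
    rw [mapEntropy_pair_comm]
    exact mapEntropy_pair_eq_right_of_determined S k' k hdet
  have h := mapEntropy_pair_sub_le_pair_sub S f k k'
  rw [h1, h2] at h
  exact h

/-- Conditional entropy is non-negative: `0 ≤ H(f | k)`. [folklore] -/
theorem codingVolume_ent_cond_nonneg (S : Finset Ω) (f : Ω → β) (k : Ω → γ) :
    0 ≤ mapEntropy S (fun v => (f v, k v)) - mapEntropy S k :=
  sub_nonneg.mpr (mapEntropy_le_mapEntropy_pair S f k)

/-- Conditional entropy of a determined quantity vanishes: `H(f | k) = 0` when `f` is determined by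
`k`. [folklore] -/
theorem codingVolume_ent_cond_eq_zero (S : Finset Ω) (f : Ω → β) (k : Ω → γ)
    (hdet : ∀ v ∈ S, ∀ u ∈ S, k v = k u → f v = f u) :
    mapEntropy S (fun v => (f v, k v)) - mapEntropy S k = 0 :=
  sub_eq_zero.mpr (mapEntropy_pair_eq_right_of_determined S f k hdet)

/-- CONDITIONAL SUBADDITIVITY: `H(f, g | k) ≤ H(f | k) + H(g | k)`. [folklore] -/
theorem codingVolume_ent_cond_subadd (S : Finset Ω) (f : Ω → β) (g : Ω → β') (k : Ω → γ) :
    mapEntropy S (fun v => ((f v, g v), k v)) - mapEntropy S k ≤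
      (mapEntropy S (fun v => (f v, k v)) - mapEntropy S k) +
      (mapEntropy S (fun v => (g v, k v)) - mapEntropy S k) := by
  have := mapEntropy_pair_strong_subadditivity S f g k
  linarith

/-- A lower bound for a conditional entropy by a determined quantity:
`H(g | k) ≤ H(f | k)` when `g` is determined by `(f, k)`... in the special form used here: if `g`
is determined by `f` together with `k`, then `H(g, k) ≤ H(f, k)`. [folklore] -/
theorem codingVolume_ent_pair_le_of_determined (S : Finset Ω) (g : Ω → β') (f : Ω → β) (k : Ω → γ)
    (hdet : ∀ v ∈ S, ∀ u ∈ S, f v = f u → k v = k u → g v = g u) :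
    mapEntropy S (fun v => (g v, k v)) ≤ mapEntropy S (fun v => (f v, k v)) := by
  refine codingVolume_ent_le_of_determined S _ _ fun v hv u hu h => ?_
  simp only [Prod.mk.injEq] at h ⊢
  exact ⟨hdet v hv u hu h.1 h.2, h.2⟩

/-- **THE CREDIT LEMMA.** If `w` is determined by `f` and also by `k₂`, and `k₁` is determined by
`k₂`, then `H(w | k₁) ≤ H(f | k₁) − H(f | k₂)`: refining the condition from `k₁` to `k₂` costs `f`
at least the conditional entropy of any quantity it shares with `k₂`. (Chain rule
`H(f | k₁) = H(w | k₁) + H(f | w, k₁)` and `H(f | k₂) ≤ H(f | w, k₁)`.) [folklore] -/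
theorem codingVolume_ent_credit (S : Finset Ω) (f : Ω → β) (w : Ω → β') (k₁ : Ω → γ) (k₂ : Ω → γ')
    (hwf : ∀ v ∈ S, ∀ u ∈ S, f v = f u → w v = w u)
    (hwk : ∀ v ∈ S, ∀ u ∈ S, k₂ v = k₂ u → w v = w u)
    (hkk : ∀ v ∈ S, ∀ u ∈ S, k₂ v = k₂ u → k₁ v = k₁ u) :
    mapEntropy S (fun v => (w v, k₁ v)) - mapEntropy S k₁ ≤
      (mapEntropy S (fun v => (f v, k₁ v)) - mapEntropy S k₁) -
      (mapEntropy S (fun v => (f v, k₂ v)) - mapEntropy S k₂) := by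
  have h1 : mapEntropy S (fun v => (f v, k₁ v)) = mapEntropy S (fun v => ((f v, w v), k₁ v)) := by
    refine mapEntropy_eq_of_ker_eq fun a ha b hb => ?_
    simp only [Prod.mk.injEq]
    constructor
    · rintro ⟨hf, hk⟩
      exact ⟨⟨hf, hwf a ha b hb hf⟩, hk⟩
    · rintro ⟨⟨hf, -⟩, hk⟩
      exact ⟨hf, hk⟩
  have h2 := codingVolume_ent_chain S f w k₁
  have h3 := codingVolume_ent_cond_le_of_determined S f k₂ (fun v => (w v, k₁ v))
    (fun v hv u hu h => Prod.ext (hwk v hv u hu h) (hkk v hv u hu h))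
  rw [h1]
  linarith

/-- One bit carries at most one bit: `H(b) ≤ 1` for a Boolean-valued map. [folklore] -/
theorem codingVolume_ent_bool_le_one (S : Finset Ω) (b : Ω → Bool) : mapEntropy S b ≤ 1 := by
  rcases S.eq_empty_or_nonempty with rfl | hS
  · rw [mapEntropy_empty]
    exact zero_le_one
  have hfib : ∀ z : Unit, ((S.image b).filter fun y => (fun _ : Bool => ()) y = z).card ≤ 2 ^ 1 := by
    intro z
    calc ((S.image b).filter fun y => (fun _ : Bool => ()) y = z).card ≤ (S.image b).card :=
          Finset.card_filter_le _ _
      _ ≤ (univ : Finset Bool).card := Finset.card_le_card (Finset.subset_univ _)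
      _ = 2 ^ 1 := by simp
  have h := mapEntropy_sub_le_mapEntropy_comp hS b (fun _ => ()) 1 hfib
  have hc : mapEntropy S ((fun _ : Bool => ()) ∘ b) = 0 := mapEntropy_const S ()
  rw [hc] at h
  push_cast at h
  linarith

end Generic

section Mask

variable {Ω α γ : Type*} [Fintype α] [DecidableEq α] [DecidableEq γ]

omit [Fintype α] in
/-- Masks are monotone: the family restricted to `E ⊆ E'` is determined by the family restricted to
`E'`. [folklore] -/
theorem codingVolume_mask_mono {E E' : Finset α} (hEE : E ⊆ E') (V : Ω → α → Bool) (x x' : Ω)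
    (h : (fun b => if b ∈ E' then V x b else false) = fun b => if b ∈ E' then V x' b else false) :
    (fun b => if b ∈ E then V x b else false) = fun b => if b ∈ E then V x' b else false := by
  funext b
  by_cases hb : b ∈ E
  · have hb' := congrFun h b
    simp only [hEE hb, if_true] at hb'
    simp only [hb, if_true, hb']
  · simp only [hb, if_false]

omit [Fintype α] in
/-- Two points have the same `E`-mask iff the family agrees on `E`. [folklore] -/
theorem codingVolume_mask_eq_iff (E : Finset α) (V : Ω → α → Bool) (x x' : Ω) :
    ((fun b => if b ∈ E then V x b else false) = fun b => if b ∈ E then V x' b else false) ↔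
      ∀ b ∈ E, V x b = V x' b := by
  constructor
  · intro h b hb
    have hb' := congrFun h b
    simpa only [hb, if_true] using hb'
  · intro h
    funext b
    by_cases hb : b ∈ E
    · simp only [hb, if_true, h b hb]
    · simp only [hb, if_false]

/-- The mask over a union carries the same information as the pair of masks. [folklore] -/
theorem codingVolume_mask_union (S : Finset Ω) (E₁ E₂ : Finset α) (V : Ω → α → Bool) (k : Ω → γ) :
    mapEntropy S (fun x => ((fun b => if b ∈ E₁ ∪ E₂ then V x b else false), k x)) =
      mapEntropy S (fun x => (((fun b => if b ∈ E₁ then V x b else false),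
        (fun b => if b ∈ E₂ then V x b else false)), k x)) := by
  refine mapEntropy_eq_of_ker_eq fun a _ a' _ => ?_
  simp only [Prod.mk.injEq]
  rw [codingVolume_mask_eq_iff (E₁ ∪ E₂) V a a', codingVolume_mask_eq_iff E₁ V a a',
    codingVolume_mask_eq_iff E₂ V a a']
  simp only [Finset.mem_union]
  constructor
  · rintro ⟨h, hk⟩
    exact ⟨⟨fun b hb => h b (Or.inl hb), fun b hb => h b (Or.inr hb)⟩, hk⟩
  · rintro ⟨⟨h₁, h₂⟩, hk⟩
    refine ⟨fun b hb => ?_, hk⟩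
    rcases hb with hb | hb
    · exact h₁ b hb
    · exact h₂ b hb

/-- The empty mask is constant, so its conditional entropy vanishes. [folklore] -/
theorem codingVolume_mask_empty (S : Finset Ω) (V : Ω → α → Bool) (k : Ω → γ) :
    mapEntropy S (fun x => ((fun b => if b ∈ (∅ : Finset α) then V x b else false), k x)) -
      mapEntropy S k = 0 :=
  codingVolume_ent_cond_eq_zero S _ k fun v _ u _ _ => by simp

/-- **FINITE CONDITIONAL SUBADDITIVITY for masked families**:
`H(V|_{⋃_{v ∈ s} E v} | k) ≤ Σ_{v ∈ s} H(V|_{E v} | k)`. [folklore] -/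
theorem codingVolume_mask_biUnion_le {σ : Type*} (S : Finset Ω) (V : Ω → α → Bool) (k : Ω → γ)
    (s : Finset σ) (E : σ → Finset α) :
    mapEntropy S (fun x => ((fun b => if b ∈ s.biUnion E then V x b else false), k x)) -
        mapEntropy S k ≤
      ∑ v ∈ s, (mapEntropy S (fun x => ((fun b => if b ∈ E v then V x b else false), k x)) -
        mapEntropy S k) := by
  classical
  induction s using Finset.induction_on with
  | empty =>
    rw [Finset.sum_empty, Finset.biUnion_empty, codingVolume_mask_empty]
  | insert v s hv ih =>
    rw [Finset.biUnion_insert, codingVolume_mask_union, Finset.sum_insert hv]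
    have h := codingVolume_ent_cond_subadd S (fun x => fun b => if b ∈ E v then V x b else false)
      (fun x => fun b => if b ∈ s.biUnion E then V x b else false) k
    linarith

/-- Sub-masks have smaller conditional entropy: `E ⊆ E'` gives `H(V|_E | k) ≤ H(V|_{E'} | k)`.
[folklore] -/
theorem codingVolume_mask_cond_mono (S : Finset Ω) {E E' : Finset α} (hEE : E ⊆ E') (V : Ω → α → Bool)
    (k : Ω → γ) :
    mapEntropy S (fun x => ((fun b => if b ∈ E then V x b else false), k x)) ≤
      mapEntropy S (fun x => ((fun b => if b ∈ E' then V x b else false), k x)) :=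
  codingVolume_ent_pair_le_of_determined S _ _ k fun _ _ _ _ h _ => codingVolume_mask_mono hEE V _ _ h

/-- **A masked family of `|E|` bits has conditional entropy at most `|E|`.** [folklore] -/
theorem codingVolume_mask_le_card (S : Finset Ω) (V : Ω → α → Bool) (k : Ω → γ) (E : Finset α) :
    mapEntropy S (fun x => ((fun b => if b ∈ E then V x b else false), k x)) - mapEntropy S k ≤
      E.card := by
  have h := codingVolume_mask_biUnion_le S V k E (fun b => ({b} : Finset α))
  rw [Finset.biUnion_singleton_eq_self] at h
  refine h.trans ?_
  have hone : ∀ b ∈ E, mapEntropy S (fun x => ((fun b' => if b' ∈ ({b} : Finset α) then V x b'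
      else false), k x)) - mapEntropy S k ≤ 1 := by
    intro b _
    have hsub := mapEntropy_prod_le S (fun x => fun b' => if b' ∈ ({b} : Finset α) then V x b'
      else false) k
    have hbit : mapEntropy S (fun x => fun b' => if b' ∈ ({b} : Finset α) then V x b' else false) =
        mapEntropy S (fun x => V x b) := by
      refine mapEntropy_eq_of_ker_eq fun a _ a' _ => ?_
      rw [codingVolume_mask_eq_iff]
      simp
    have hle := codingVolume_ent_bool_le_one S (fun x => V x b)
    linarith
  calc ∑ b ∈ E, (mapEntropy S (fun x => ((fun b' => if b' ∈ ({b} : Finset α) then V x b'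
        else false), k x)) - mapEntropy S k) ≤ ∑ _b ∈ E, (1 : ℝ) := Finset.sum_le_sum hone
    _ = E.card := by simp

/-- Unconditional form: `H(V|_E) ≤ |E|`. [folklore] -/
theorem codingVolume_mask_le_card' (S : Finset Ω) (V : Ω → α → Bool) (E : Finset α) :
    mapEntropy S (fun x => fun b => if b ∈ E then V x b else false) ≤ E.card := by
  have h := codingVolume_mask_le_card S V (fun _ => ()) E
  have h0 : mapEntropy S (fun _ : Ω => ()) = 0 := mapEntropy_const S ()
  have h1 : mapEntropy S (fun x => ((fun b => if b ∈ E then V x b else false), ())) =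
      mapEntropy S (fun x => fun b => if b ∈ E then V x b else false) := by
    refine mapEntropy_eq_of_ker_eq fun a _ a' _ => ?_
    simp only [Prod.mk.injEq, and_true]
  rw [h0, h1] at h
  linarith

end Mask

section Cube

variable {ι : Type} [Fintype ι] [DecidableEq ι] {β : Type*} [DecidableEq β]

/-- **Fresh independent bits add their number (masked form)**: if `F` ignores the coordinates in
`Q`, then `H(F, x|_Q) = H(F) + |Q|` for a uniform point `x` of the cube, with `x|_Q` the total
function `i ↦ if i ∈ Q then x i else false`. [folklore] -/
theorem codingVolume_ent_pair_coords (Q : Finset ι) (F : (ι → Bool) → β)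
    (hF : ∀ x x' : ι → Bool, (∀ i, i ∉ Q → x i = x' i) → F x = F x') :
    mapEntropy (univ : Finset (ι → Bool)) (fun x => (F x, fun i => if i ∈ Q then x i else false)) =
      mapEntropy (univ : Finset (ι → Bool)) F + Q.card := by
  rw [← codingVolume_mapEntropy_pair_coords Q F hF]
  refine mapEntropy_eq_of_ker_eq fun a _ b _ => ?_
  simp only [Prod.mk.injEq, funext_iff, Subtype.forall]
  refine and_congr_right fun _ => ⟨fun h i hi => ?_, fun h i => ?_⟩
  · simpa only [hi, if_true] using h i
  · by_cases hi : i ∈ Q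
    · simp only [hi, if_true, h i hi]
    · simp only [hi, if_false]

/-- Conditional form: `H(x|_Q | F) = |Q|` when `F` ignores the coordinates in `Q`. [folklore] -/
theorem codingVolume_ent_coords_cond (Q : Finset ι) (F : (ι → Bool) → β)
    (hF : ∀ x x' : ι → Bool, (∀ i, i ∉ Q → x i = x' i) → F x = F x') :
    mapEntropy (univ : Finset (ι → Bool)) (fun x => ((fun i => if i ∈ Q then x i else false), F x)) -
      mapEntropy (univ : Finset (ι → Bool)) F = Q.card := by
  rw [mapEntropy_pair_comm, codingVolume_ent_pair_coords Q F hF]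
  ring

/-- The masked coordinates `x|_Q` of a uniform point of the cube have entropy `|Q|`. [folklore] -/
theorem codingVolume_ent_coords (Q : Finset ι) :
    mapEntropy (univ : Finset (ι → Bool)) (fun x : ι → Bool => fun i => if i ∈ Q then x i else false) =
      Q.card := by
  have h := codingVolume_ent_pair_coords (β := Unit) Q (fun _ => ()) (fun _ _ _ => rfl)
  rw [mapEntropy_const, zero_add] at h
  rw [← h]
  refine mapEntropy_eq_of_ker_eq fun a _ b _ => ?_
  simp only [Prod.mk.injEq, true_and]

end Cube

end Summit.PneNP.PneNP.Theorems
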